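import Summits.QuantumFields.YangMills.Theorems.UnitScaleTiltProp8FlatRowsWhole
import Summits.QuantumFields.YangMills.Theorems.UnitScaleTiltProp8FlatHLapWhole
import HarnessLib

/-!
# Route `UnitScaleTilt`, crux K1 child «MinimiserStabilityRegPr» (stmt-QuantumFields-19200), v8 pillar **P2 `stub_flatOpsCubeSeq`** — OWNER RULING g21-№4 §B3(a)
# one-level target, CLOSED: **THE INPUT ROW LIST `FlatOpsLettersAssembly.RowsAt` OF THE REGISTERED P2 TEXT HOLDS UNCONDITIONALLY AT THE ONE-LEVEL FAMILY
# `Domains.whole (K − n)`** (the small-torus / pure small-field case of [Balaban1985Variational] Sect. F, [Balaban1984PropagatorsII] p. 224 «Ω_j = T_η for j = 1, …, l»)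
# — every row a theorem: (k1), (k2) `FlatHWholeBridge.hKernelRows12_whole` ([Balaban1984PropagatorsI] (1.63)–(1.66)), (k3) `FlatHCurlCurlWhole.hKernelRow3_whole`
# ((137) + (2.148)), (k4) `FlatHLapWhole.hKernelRow4_whole` ((130): (1.110)₄ ∘ (2.148)), (162) `FlatRowsWhole.rowSum162_whole`, the `G`-rows `FlatDomainsCongr.gRows_whole`
# ((1.115)), the `Q`-row `FlatCubeQContraction.qContrLetter_whole`

Cell `ym3-torus` (HUMAN RULING D-0037, YM ladder rung R3), seat `ym3-torus-p1` gen 16.  `--supports stmt-QuantumFields-19200 --as helper`; count-neutral; def-free.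

WHAT IS PROVED (sorry-free; axioms standard; no definition).  **`rowsAt_whole`**: for every odd `L > 1` there are constants `δ > 0`, `C_G > 0`, `C ≥ 0` such that for every
member `F.L = L`, all heights `n < K` and P2 weights `w`: `RowsAt F n K (Domains.whole (K − n)) w (max C (C·B₃)) δ B₃ C_G 1` with `B₃ = 3(4/δ + 1)K₃(δ/4)` and
`dBI := distBI` — i.e. the body of `FlatCubeOpsText.FlatOpsAdmAtMS` at the datum `D := Domains.whole (K − n)` follows by `FlatOpsLettersAssembly.body_of_rowsAt`
(`body_whole`).  So the registered text is CONSISTENT and inhabited in its one-level case with p1 g14's constants; what remains of P2 is the multi-level case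
(nested families with a level-0 region: G-F3′-L0 in `KernelRowsAt` shape, `FlatOpsFromKernelRows.flatOpsAdmAtMS_of_kernelRows`).
HONEST SCOPE: the one-level family is ONE admissible datum of the text (which quantifies over all admissible `D`); nothing here proves the stub; NOT a claim about the mass gap.

References: T. Bałaban, CMP **102** (1985) 277–309 [Balaban1985Variational] (46) p.285, (130) p.298, (137)–(140) p.298–299, (161)–(163) p.303, (165) p.304; CMP **96** (1984)
223–250 [Balaban1984PropagatorsII] (2.1) p.224, (2.148)–(2.151) p.249; CMP **95** (1984) 17–40 [Balaban1984PropagatorsI] (1.63)–(1.66) p.29, (1.110) p.35, (1.115) p.36.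
-/

set_option autoImplicit false

noncomputable section

open scoped BigOperators

namespace Summit.QuantumFields.YangMills.Theorems.FlatRowsWholeClosed

open Literature.MathematicalPhysics.QuantumFieldTheory.Balaban1983to89
open B6SectADomainsV1 (Domains)
open B6SectAOperatorsV1 (BondIdx)
open B5Prop12FieldsLattice (distSite_nonneg)
open B5Hk163TorusHolderDecay (MD163)
open B5Hk163Decay (MG163)
open B5Hk163Strip (kappa163)
open B4TorusKernel (periodConst)
open B4Sect5Proof (latticeConst)
open T3ContinuumYM3Torus (T3Family)
open FlatCubeOpsText (distBI IsLevWeight IsFlatH IsFlatGt HSupLetterG GtSupLetterG GtLaplaceLetterG HDecayLetterD RowSum162)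
open FlatOpsLettersAssembly (flatH RowsAt body_of_rowsAt)
open FlatOpsHRowsFromKernels (HKernelRows hRows_of_kernelRows)
open FlatDomainsCongr (gRows_whole)
open FlatHWholeBridge (hKernelRows12_whole)
open FlatHCurlCurlWhole (hKernelRow3_whole)
open FlatHLapWhole (hKernelRow4_whole)
open FlatRowsWhole (rowSum162_whole)
open FlatCubeQContraction (qContrLetter_whole)
open FlatMinimizerH (le_T3)

/-- a slower rate dominates: `e^{−κd} ≤ e^{−δd}` for `δ ≤ κ`, `d ≥ 0`. [folklore] -/
theorem exp_rate_mono {δ κ d : ℝ} (h : δ ≤ κ) (hd : 0 ≤ d) : Real.exp (-(κ * d)) ≤ Real.exp (-(δ * d)) :=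
  Real.exp_le_exp.2 (neg_le_neg (mul_le_mul_of_nonneg_right h hd))

/-- the physical distance `distBI` is nonnegative. [cite: Balaban1985Variational, (161) p.303] -/
theorem distBI_nonneg' {P : Params} (D : Domains P) (b : PBond P 0) (c : BondIdx D) : 0 ≤ distBI D b c := by
  unfold distBI
  exact mul_nonneg (pow_nonneg (inv_nonneg.2 (Nat.cast_nonneg _)) _) (distSite_nonneg _ _)

/-- a kernel row `|x| ≤ C₁e^{−κd}` with `C₁ ≤ C`, `δ ≤ κ`, `d ≥ 0` gives `|x| ≤ Ce^{−δd}` (`C₁ ≥ 0` read off the row itself). [folklore] -/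
theorem row_mono {x C₁ C κ δ d : ℝ} (hx : x ≤ C₁ * Real.exp (-(κ * d))) (hx0 : 0 ≤ x) (hC : C₁ ≤ C) (hδ : δ ≤ κ) (hd : 0 ≤ d) :
    x ≤ C * Real.exp (-(δ * d)) := by
  have hE : 0 < Real.exp (-(κ * d)) := Real.exp_pos _
  have hC₁ : 0 ≤ C₁ := le_of_mul_le_mul_right (by rw [zero_mul]; exact hx0.trans hx) hE
  exact hx.trans ((mul_le_mul_of_nonneg_left (exp_rate_mono hδ hd) hC₁).trans (mul_le_mul_of_nonneg_right hC (Real.exp_pos _).le))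

/-- **THE ROW LIST OF P2 HOLDS AT THE ONE-LEVEL FAMILY, UNCONDITIONALLY** (see the module docstring for the sources of the seven rows).
[cite: Balaban1985Variational, (46) p.285, (130) p.298, (137)-(140) p.298, (161)-(163) p.303, (165) p.304; Balaban1984PropagatorsII, Cor. 2.8 (2.150)-(2.151) p.249, (2.148) p.249; Balaban1984PropagatorsI, (1.63)-(1.66) p.29, (1.110) p.35, (1.115) p.36] -/
theorem rowsAt_whole (L : ℕ) (hL : Odd L ∧ 1 < L) :
    ∃ (δ CG C : ℝ), 0 < δ ∧ 0 < CG ∧ 0 ≤ C ∧ ∀ (F : T3Family), F.L = L → ∀ (n K : ℕ), n < K →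
      ∀ (w : ℕ → PBond (F.P K) 0 → ℝ), IsLevWeight F n K (Domains.whole (K - n) (le_T3 F n K)) w →
      RowsAt F n K (Domains.whole (K - n) (le_T3 F n K)) w (max C (C * (3 * (4 / δ + 1) * latticeConst 3 (δ / 4)))) δ
        (3 * (4 / δ + 1) * latticeConst 3 (δ / 4)) CG 1 := by
  obtain ⟨CG, hCG, hG⟩ := gRows_whole L hL
  obtain ⟨δ₃, hδ₃, C₃, hC₃, h3⟩ := hKernelRow3_whole L hL
  obtain ⟨δ₄, hδ₄, C₄, hC₄, h4⟩ := hKernelRow4_whole L hL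
  have hκ : 0 < kappa163 3 / 3 := div_pos (B5Hk163Strip.kappa163_pos 3) (by norm_num)
  set δ : ℝ := min (min (kappa163 3 / 3) δ₃) δ₄ with hδdef
  have hδ : 0 < δ := lt_min (lt_min hκ hδ₃) hδ₄
  have hδκ : δ ≤ kappa163 3 / 3 := (min_le_left _ _).trans (min_le_left _ _)
  have hδ3 : δ ≤ δ₃ := (min_le_left _ _).trans (min_le_right _ _)
  have hδ4 : δ ≤ δ₄ := min_le_right _ _
  set C : ℝ := max (max (max (MG163 3 * periodConst (kappa163 3) (3 - 1)) (MD163 3 * periodConst (kappa163 3) (3 - 1))) C₃) C₄ with hCdef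
  have hC : 0 ≤ C := le_trans hC₄ (le_max_right _ _)
  refine ⟨δ, CG, C, hδ, hCG, hC, fun F hF n K hnK w hw => ?_⟩
  have hc₀ : MG163 3 * periodConst (kappa163 3) (3 - 1) ≤ C :=
    (((le_max_left _ _).trans (le_max_left _ _)).trans (le_max_left _ _))
  have hc₁ : MD163 3 * periodConst (kappa163 3) (3 - 1) ≤ C :=
    (((le_max_right _ _).trans (le_max_left _ _)).trans (le_max_left _ _))
  have hc₃ : C₃ ≤ C := (le_max_right _ _).trans (le_max_left _ _)
  have hc₄ : C₄ ≤ C := le_max_right _ _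
  have hk : HKernelRows F n K (Domains.whole (K - n) (le_T3 F n K)) (fun b c => distBI (Domains.whole (K - n) (le_T3 F n K)) b c) w
      (flatH F n K (Domains.whole (K - n) (le_T3 F n K))) C δ := by
    intro c e he he' b
    obtain ⟨h1, h2⟩ := hKernelRows12_whole F n K w hw c e he he' b
    have h3b := h3 F hF n K w hw c e he he' b
    have h4b := h4 F hF n K w hw c e he he' b
    have hd0 := distBI_nonneg' (Domains.whole (K - n) (le_T3 F n K)) b c
    have hw0 := FlatOpsHRowsFromKernels.levBase_bounds hw b
    have hL0 : (0 : ℝ) ≤ (F.L : ℝ) ^ (K - n) := pow_nonneg (Nat.cast_nonneg _) _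
    refine ⟨row_mono h1 (abs_nonneg _) hc₀ hδκ hd0, fun ν => row_mono (h2 ν) ?_ hc₁ hδκ hd0, row_mono h3b ?_ hc₃ hδ3 hd0, row_mono h4b ?_ hc₄ hδ4 hd0⟩
    · exact mul_nonneg (mul_nonneg hw0.1 hL0) (abs_nonneg _)
    · exact mul_nonneg (by rw [hw0.2.2.2]; exact mul_nonneg hw0.1 (by rw [hw0.2.2.1]; exact mul_nonneg hw0.1 hw0.1)) (abs_nonneg _)
    · exact mul_nonneg (mul_nonneg (by rw [hw0.2.2.1]; exact mul_nonneg hw0.1 hw0.1) (pow_nonneg hL0 _)) (abs_nonneg _)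
  have hrow := rowSum162_whole F n K hδ w hw
  obtain ⟨hs, hl, hcomp, hr, hd⟩ := hRows_of_kernelRows hw rfl hC (by linarith : δ / 2 ≤ δ) (fun b c => le_rfl) hk hrow
  obtain ⟨w', hw', G, hGpin, hGs, hGl⟩ := hG F hF n K hnK w hw
  exact ⟨⟨hs, hl, _, hcomp, hr, hd⟩, ⟨w', hw', G, hGpin, hGs, hGl⟩, qContrLetter_whole F n K (le_T3 F n K) w hw⟩

/-- **THE BODY OF THE REGISTERED P2 TEXT AT THE ONE-LEVEL DATUM**: for every odd `L > 1` there is `B₀` (and the `δ`, `B₃` of `rowsAt_whole`) such that for every member,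
all heights and P2 weights, the `∃ H G̃ dBI …` body of `FlatCubeOpsText.FlatOpsAdmAtMS` holds at `D := Domains.whole (K − n)` — `rowsAt_whole` through
`FlatOpsLettersAssembly.body_of_rowsAt`. [cite: Balaban1985Variational, (46) p.285, (157)-(158) p.302, (161)-(163) p.303, (165) p.304; Balaban1984PropagatorsII, (2.1) p.224] -/
theorem body_whole (L : ℕ) (hL : Odd L ∧ 1 < L) :
    ∃ (B₀ δ B₃ : ℝ), 0 < δ ∧ ∀ (F : T3Family), F.L = L → ∀ (n K : ℕ), n < K →
      ∀ (w : ℕ → PBond (F.P K) 0 → ℝ), IsLevWeight F n K (Domains.whole (K - n) (le_T3 F n K)) w →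
      ∃ (H : (BondIdx (Domains.whole (K - n) (le_T3 F n K) : Domains (F.P K)) → ℝ) →ₗ[ℝ] (PBond (F.P K) 0 → ℝ))
        (Gt : (PBond (F.P K) 0 → ℝ) →ₗ[ℝ] (PBond (F.P K) 0 → ℝ)),
        IsFlatH F n K (Domains.whole (K - n) (le_T3 F n K)) H ∧ IsFlatGt F n K (Domains.whole (K - n) (le_T3 F n K)) Gt ∧
        HSupLetterG F n K (Domains.whole (K - n) (le_T3 F n K)) w H B₀ ∧ GtSupLetterG F n K w Gt B₀ ∧ GtLaplaceLetterG F n K w Gt B₀ ∧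
        ∃ dBI : PBond (F.P K) 0 → BondIdx (Domains.whole (K - n) (le_T3 F n K) : Domains (F.P K)) → ℝ,
          (∀ b c, distBI (Domains.whole (K - n) (le_T3 F n K)) b c ≤ dBI b c) ∧ RowSum162 F n K (Domains.whole (K - n) (le_T3 F n K)) dBI w δ B₃ ∧
            HDecayLetterD F n K (Domains.whole (K - n) (le_T3 F n K)) dBI w H B₀ δ := by
  obtain ⟨δ, CG, C, hδ, hCG, hC, h⟩ := rowsAt_whole L hL
  refine ⟨max (max C (C * (3 * (4 / δ + 1) * latticeConst 3 (δ / 4)))) (CG + max C (C * (3 * (4 / δ + 1) * latticeConst 3 (δ / 4))) * 1 * CG), δ,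
    3 * (4 / δ + 1) * latticeConst 3 (δ / 4), hδ, fun F hF n K hnK w hw => ?_⟩
  exact body_of_rowsAt (FlatOpsLettersAssembly.levWeight_nonneg hw) hCG.le zero_le_one (h F hF n K hnK w hw)

end Summit.QuantumFields.YangMills.Theorems.FlatRowsWholeClosed

end
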